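import Literature.MathematicalPhysics.QuantumFieldTheory.Balaban1983to89.B3Eq119ChargedGraphs
import Literature.MathematicalPhysics.QuantumFieldTheory.Balaban1983to89.B1Eq331Model

/-!
# `Balaban1983to89.B3Eq119VectorPropagator` — T. Bałaban, *(Higgs)₂,₃ quantum fields in a finite volume. III.
# Renormalization*, Commun. Math. Phys. **88** (1983) 411–445 [Balaban1983Higgs3], (1.20)–(1.21) p. 416: «The propagators
# are C^ε_0 for the scalar field and C^ε = (−Δ^ε + μ₀²)^{−1} for the vector field» — THE GREEN'S-FUNCTION EQUATION OF THE
# VECTOR PROPAGATOR of the `e > 0` graph expansion of (1.19) (companion of `B3Eq119ChargedGraphs` §6)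

statement-level skeleton of published theorems with citation tags; proofs where landed; nothing here is a claim about
the Yang–Mills mass gap

CITATION HEADER (lean-in-tree rule).  Part of the lit-balaban TYPED SKELETON (HOME `run/shared/lean/pub/lit-balaban/`),
Phase 2, proof seat p33 (gen 72, unit `lit-balaban-p33`); row **B3.Eq1.19-1.22** of `HOME/lit-balaban-r15/ROWS-B3.md` (fold
owner r15; head `proved`, Q25/Q28 — OPTIONAL located member of the (1.19)/(1.21) cell, zero head weight).  REUSED BY NAME,
nothing re-declared: `B3Eq119ChargedGraphs.{vecForm, vecForm_self, vecForm_comm, precA, precA_transpose, precA_posDef,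
dotProduct_precA_mulVec, fcA, fcA_dotProduct_single, propA, jprec, aLeg, inv_aLeg_aLeg}` (this seat, p366173), gen 71's
`B3Eq119ConnectedGraphs.{freeOp, freeOp_apply, siteInner_freeOp_comm, vecAction}`, p12/p16's `B1Eq331Model.vecLaplaceForm_eq_siteInner`
(«N = d and an external vector field A = 0»: the vector kinetic form is the scalar Laplacian form of `toSite A`), the typer's
`B3MultiscaleFields.{toSite, ofSite, toSite_add, toSite_ofSite, zeroCharge}`, `HiggsFluctMeasureCov.siteInner_toSite_toSite`,
`HiggsCovariancePos.eq_zero_of_siteInner_self_eq_zero`.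

THE PRINT (p. 416 = PDF 6, L20–21): «The propagators are C^ε_0 for the scalar field and C^ε = (−Δ^ε + μ₀²)^{−1} for the vector
field (of course internal indices and vector indices are understood here)»; (1.20): `S^ε(A,φ) = ½‖dA‖² + ½μ₀²‖A‖² + …`
in the componentwise (Feynman) form of [Balaban1982Higgs1] (1.11): `½Σ_μ⟨A_μ,(−Δ^ε)A_μ⟩`.

THE ARGUMENT (ours).  §1: the bilinear form `⟨A,(−Δ^ε+μ₀²)B⟩` of `B3Eq119ChargedGraphs.vecForm` equals the scalar form
`⟨toSite A, (−Δ^ε_0+μ₀²) toSite B⟩` of the `d`-component site field (diagonal case = `vecLaplaceForm_eq_siteInner`, then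
polarization of two symmetric bilinear forms).  §2: the column `C^ε(·,b′) = fcA⁻¹(precA⁻¹·fcA δ_{b′})` satisfies the weak equation
`⟨A,(−Δ^ε+μ₀²)C^ε(·,b′)⟩ = A_{b′} = ⟨toSite A, ε^{−d} toSite δ_{b′}⟩` for every `A` (`precA·precA⁻¹ = 1`), hence, `toSite` being onto and
the scalar product (I.1.5) non-degenerate, `(−Δ^ε_0+μ₀²) toSite C^ε(·,b′) = ε^{−d} toSite δ_{b′}`; and the vector–vector pair weight
of the graph expansion (`inv_aLeg_aLeg`) is this column.

WHAT IS PROVED (sorry-free; any level `k`; `[DecidableEq (PBond P k)]` supplied by the user in §2): `vecForm_self_eq_siteInner`,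
**`vecForm_eq_siteInner`**, `vecPropCol`, `propA_symm`, `vecPropCol_apply`, `vecForm_vecPropCol` (weak equation),
**`freeOp_toSite_vecPropCol`** (`C^ε = (−Δ^ε+μ₀²)^{−1}` as the Green's-function equation), **`inv_aLeg_aLeg_eq_green`**.

HONEST SCOPE.  Feynman-gauge componentwise Laplacian as in (1.20)/(I.1.11) (no gauge-fixing discussion); `μ₀² > 0`; the torus
kernel / decay of `C^ε` (p37's `B3Eq122TorusPropagators`) is not bridged here.
-/

noncomputable section

open MeasureTheory Matrix Finset
open scoped BigOperators InnerProductSpace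

namespace Literature.MathematicalPhysics.QuantumFieldTheory.Balaban1983to89.B3Eq119VectorPropagator

open HiggsLattice HiggsCovariance B1Eq221Coordinates B3MultiscaleFields B3Eq119ConnectedGraphs B3Eq119ChargedGraphs
open HiggsCovariancePos (siteInner_covLaplacianN_univ_self eq_zero_of_siteInner_self_eq_zero)
open HiggsFluctMeasurePos (siteInner_comm siteInner_add_right siteInner_sub_right siteInner_smul_right siteInner_smul_left)
open HiggsFluctMeasureCov (siteInner_toSite_toSite)
open B1Eq331Model (vecLaplaceForm_eq_siteInner)

variable {P : HiggsLattice.Params} {k : ℕ}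

/-! ## §1 The vector form is the componentwise scalar form of the `ℝ^d`-valued site field `toSite A` -/

/-- **Diagonal identity**: `⟨A,(−Δ^ε+μ₀²)A⟩ = ⟨toSite A, (−Δ^ε_0 + μ₀²) toSite A⟩` — the free vector action in Feynman gauge is the
free scalar action of the `d`-component site field `x ↦ (A_μ(x))_μ` at zero charge («N = d and an external vector field
A = 0»). [cite: Balaban1982Higgs1, (1.11) p.605; p.608] [cite: Balaban1983Higgs3, (1.20) p.416] -/
theorem vecForm_self_eq_siteInner (mu0sq : ℝ) (A : HiggsLattice.VecField P k) :
    vecForm P k mu0sq A A = siteInner (toSite A) (freeOp (zeroCharge P.d) mu0sq (toSite A)) := by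
  rw [vecForm_self, vecAction, vecLaplaceForm_eq_siteInner, freeOp_apply, siteInner_add_right, siteInner_smul_right,
    siteInner_toSite_toSite]
  have h : ∑ b : HiggsLattice.PBond P k, P.mesh k ^ P.d * (mu0sq * A b ^ 2)
      = mu0sq * (P.mesh k ^ P.d * ∑ b : HiggsLattice.PBond P k, A b * A b) := by
    rw [mul_sum, mul_sum]; exact sum_congr rfl fun b _ => by ring
  rw [h]
  ring

/-- **Polarized identity**: `⟨A,(−Δ^ε+μ₀²)B⟩ = ⟨toSite A, (−Δ^ε_0 + μ₀²) toSite B⟩` for all `A, B` (both sides are symmetric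
bilinear forms with the same diagonal). [cite: Balaban1982Higgs1, (1.11) p.605; p.608] -/
theorem vecForm_eq_siteInner (mu0sq : ℝ) (A B : HiggsLattice.VecField P k) :
    vecForm P k mu0sq A B = siteInner (toSite A) (freeOp (zeroCharge P.d) mu0sq (toSite B)) := by
  -- polarization of both sides
  have hB : ∀ X Y Z : HiggsLattice.VecField P k,
      vecForm P k mu0sq (X + Y) Z = vecForm P k mu0sq X Z + vecForm P k mu0sq Y Z := fun X Y Z => by
    rw [map_add, LinearMap.add_apply]
  have hB' : ∀ X Y Z : HiggsLattice.VecField P k,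
      vecForm P k mu0sq Z (X + Y) = vecForm P k mu0sq Z X + vecForm P k mu0sq Z Y := fun X Y Z => map_add _ _ _
  have hL : vecForm P k mu0sq A B
      = (vecForm P k mu0sq (A + B) (A + B) - vecForm P k mu0sq A A - vecForm P k mu0sq B B) / 2 := by
    rw [hB', hB, hB, vecForm_comm mu0sq B A]
    ring
  have hS : ∀ X Y Z : HiggsLattice.VecField P k,
      siteInner (toSite (X + Y)) (freeOp (zeroCharge P.d) mu0sq (toSite Z))
        = siteInner (toSite X) (freeOp (zeroCharge P.d) mu0sq (toSite Z))
          + siteInner (toSite Y) (freeOp (zeroCharge P.d) mu0sq (toSite Z)) := fun X Y Z => by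
    rw [toSite_add, siteInner_comm (toSite X + toSite Y), siteInner_add_right, siteInner_comm (toSite X),
      siteInner_comm (toSite Y)]
  have hS' : ∀ X Y Z : HiggsLattice.VecField P k,
      siteInner (toSite Z) (freeOp (zeroCharge P.d) mu0sq (toSite (X + Y)))
        = siteInner (toSite Z) (freeOp (zeroCharge P.d) mu0sq (toSite X))
          + siteInner (toSite Z) (freeOp (zeroCharge P.d) mu0sq (toSite Y)) := fun X Y Z => by
    rw [toSite_add, map_add, siteInner_add_right]
  have hR : siteInner (toSite A) (freeOp (zeroCharge P.d) mu0sq (toSite B))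
      = (siteInner (toSite (A + B)) (freeOp (zeroCharge P.d) mu0sq (toSite (A + B)))
          - siteInner (toSite A) (freeOp (zeroCharge P.d) mu0sq (toSite A))
          - siteInner (toSite B) (freeOp (zeroCharge P.d) mu0sq (toSite B))) / 2 := by
    rw [hS', hS, hS, siteInner_freeOp_comm (zeroCharge P.d) mu0sq (toSite B) (toSite A)]
    ring
  rw [hL, hR, vecForm_self_eq_siteInner, vecForm_self_eq_siteInner, vecForm_self_eq_siteInner]

/-! ## §2 The vector propagator solves `(−Δ^ε + μ₀²)C^ε = ε^{−d}δ` componentwise -/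

section Green

variable [DecidableEq (HiggsLattice.PBond P k)]

/-- The column `C^ε(·, b′)` of the vector propagator as a bond function: `fcA⁻¹(precA⁻¹ · fcA δ_{b′})`.
[cite: Balaban1983Higgs3, (1.21) p.416] -/
def vecPropCol (mu0sq : ℝ) (b' : HiggsLattice.PBond P k) : HiggsLattice.VecField P k :=
  (fcA P k).symm ((precA P k mu0sq)⁻¹ *ᵥ fcA P k (Pi.single b' (1 : ℝ)))

/-- `precA⁻¹` is symmetric. [cite: Balaban1983Higgs3, (1.20) p.416] -/
theorem precA_inv_transpose (mu0sq : ℝ) : ((precA P k mu0sq)⁻¹)ᵀ = (precA P k mu0sq)⁻¹ := by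
  rw [transpose_nonsing_inv, precA_transpose]

/-- `C^ε` is symmetric: `C^ε(b,b′) = C^ε(b′,b)`. [cite: Balaban1983Higgs3, (1.21) p.416] -/
theorem propA_symm (mu0sq : ℝ) (b b' : HiggsLattice.PBond P k) : propA P k mu0sq b b' = propA P k mu0sq b' b := by
  unfold propA
  rw [dotProduct_comm, dotProduct_mulVec, ← mulVec_transpose, precA_inv_transpose]

/-- The entries of the column are the propagator: `C^ε(·,b′)_b = C^ε(b,b′)`. [cite: Balaban1983Higgs3, (1.21) p.416] -/
theorem vecPropCol_apply (mu0sq : ℝ) (b' b : HiggsLattice.PBond P k) : vecPropCol mu0sq b' b = propA P k mu0sq b b' := by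
  rw [← fcA_dotProduct_single (vecPropCol mu0sq b') b, vecPropCol, LinearEquiv.apply_symm_apply, propA_symm, propA]

/-- The weak equation: `⟨A,(−Δ^ε+μ₀²)C^ε(·,b′)⟩ = A_{b′}` for every `A`. [cite: Balaban1983Higgs3, (1.21) p.416] -/
theorem vecForm_vecPropCol {mu0sq : ℝ} (hmu : 0 < mu0sq) (A : HiggsLattice.VecField P k) (b' : HiggsLattice.PBond P k) :
    vecForm P k mu0sq A (vecPropCol mu0sq b') = A b' := by
  have hdet : IsUnit (precA P k mu0sq).det := isUnit_iff_ne_zero.2 (precA_posDef (P := P) (k := k) hmu).det_pos.ne'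
  rw [← dotProduct_precA_mulVec, vecPropCol, LinearEquiv.apply_symm_apply, mulVec_mulVec, mul_nonsing_inv _ hdet, one_mulVec,
    fcA_dotProduct_single]

/-- `A_{b′} = ⟨toSite A, ε^{−d}·toSite δ_{b′}⟩` for the scalar product (I.1.5). [cite: Balaban1982Higgs1, (1.5) p.604] -/
theorem siteInner_toSite_single (A : HiggsLattice.VecField P k) (b' : HiggsLattice.PBond P k) :
    siteInner (toSite A) ((P.mesh k ^ P.d)⁻¹ • toSite (Pi.single b' (1 : ℝ))) = A b' := by
  have hη : P.mesh k ^ P.d ≠ 0 := (pow_pos (P.mesh_pos k) _).ne'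
  rw [siteInner_smul_right, siteInner_toSite_toSite, ← mul_assoc, inv_mul_cancel₀ hη, one_mul,
    Finset.sum_eq_single b' (fun b _ hb => by rw [Pi.single_eq_of_ne hb, mul_zero]) (fun h => absurd (mem_univ b') h),
    Pi.single_eq_same, mul_one]

/-- **THE GREEN'S-FUNCTION EQUATION OF THE VECTOR PROPAGATOR**: `C^ε = (−Δ^ε + μ₀²)^{−1}` (print, p. 416) — the column
`C^ε(·, b′)`, read as the `ℝ^d`-valued site function `toSite`, solves `(−Δ^ε_0 + μ₀²)ψ = ε^{−d}·toSite δ_{b′}` for the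
componentwise (Feynman-gauge) lattice Laplacian of (1.20) (gen 71's `freeOp` at zero charge, `N = d`), and is its unique
solution (`freeOp_injective`). [cite: Balaban1983Higgs3, (1.21) p.416] [cite: Balaban1982Higgs1, (1.11) p.605; p.608] -/
theorem freeOp_toSite_vecPropCol {mu0sq : ℝ} (hmu : 0 < mu0sq) (b' : HiggsLattice.PBond P k) :
    freeOp (zeroCharge P.d) mu0sq (toSite (vecPropCol mu0sq b'))
      = (P.mesh k ^ P.d)⁻¹ • toSite (Pi.single b' (1 : ℝ)) := by
  set ψ : HiggsLattice.ScalarField P k P.d := freeOp (zeroCharge P.d) mu0sq (toSite (vecPropCol mu0sq b')) with hψ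
  set δ : HiggsLattice.ScalarField P k P.d := (P.mesh k ^ P.d)⁻¹ • toSite (Pi.single b' (1 : ℝ)) with hδ
  have hweak : ∀ A : HiggsLattice.VecField P k, siteInner (toSite A) ψ = siteInner (toSite A) δ := fun A => by
    rw [hψ, hδ, ← vecForm_eq_siteInner, vecForm_vecPropCol hmu, siteInner_toSite_single]
  have hzero : siteInner (ψ - δ) (ψ - δ) = 0 := by
    have h := hweak (ofSite (ψ - δ))
    rw [toSite_ofSite] at h
    rw [siteInner_sub_right, h, sub_self]
  exact sub_eq_zero.1 (eq_zero_of_siteInner_self_eq_zero _ hzero)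

/-- **Hence every vector–vector pair of the graph expansion carries `(−Δ^ε + μ₀²)^{−1}`**: the pair weight of BRICK 6's
`coefX_chargeOne_eq_sum_connected` for two vector legs `A_b, A_{b′}` is the `(b, b′)` entry of the solution of the Green's
function equation. [cite: Balaban1983Higgs3, (1.21) p.416] -/
theorem inv_aLeg_aLeg_eq_green {N : ℕ} (C : ChargeData N) {msq mu0sq : ℝ} (hm : 0 < msq) (hmu : 0 < mu0sq)
    (b b' : HiggsLattice.PBond P k) :
    ((jprec P k N C msq mu0sq)⁻¹ *ᵥ aLeg b) ⬝ᵥ (aLeg b' : JCrd P k N → ℝ) = vecPropCol mu0sq b' b := by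
  rw [inv_aLeg_aLeg C hm hmu, vecPropCol_apply]

end Green

end Literature.MathematicalPhysics.QuantumFieldTheory.Balaban1983to89.B3Eq119VectorPropagator
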